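import Literature.NumberTheory.GelbartRogawski1991.LocalLeraySection
import Literature.RepresentationTheory.HeisenbergGroup.ImplementerSectionIsometric
import Literature.RepresentationTheory.HeisenbergGroup.ImplementerSectionRigidity
import Literature.NumberTheory.Automorphic.SchwartzBruhatL2Norm
import Literature.NumberTheory.Automorphic.AdelicSecondCountable
import HarnessLib

/-!
# When is the local Weil representation `ω_v = β⁻¹ · r ∘ ι_v` of `U(J)(F_v)` unitary? — reduction to isometric
# implementers and `|β| = 1`

Topic `NumberTheory/GelbartRogawski1991`; namespace
`Literature.NumberTheory.GelbartRogawski1991.UnitaryDualPair.LocalSplitting` (that of the interface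
`LocalUnitarySplittingDatum.lean`).  KERNEL ONLY: theorems; no definition, no named fact, no `sorry`.

For the tree's local splitting datum `D : LocalSplittingDatum F E c N hcδ hδ hd T hT hTd hJ v μ ℓ hℓ` at a finite place
`v` ([GelbartRogawski1991, Prop. 3.1.1] / [Kudla1994, Thm 3.1]: a Leray-normalised section `r` of implementers of the
smooth Schrödinger model `localSchrodinger F N T v` on `𝒮(F_vᴺ)`, Kudla's function `β`, `ω_v(g) = β(g)⁻¹ r(ι_v g)`):

* §1 `LocalSplittingDatum.norm_cocycle_eq_one` — the multiplier of `r` is UNITARY, `|c_r(g₁, g₂)| = 1` (it is a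
  Leray cocycle, a Weil index: tree `norm_lerayCocycle`; [MoeglinVignerasWaldspurger1987, Chap. 3 §I.3 rem. b)]);
  `monoidHom_localSp_eq_one` — `Sp(𝕎_v)` has no non-trivial homomorphism to a commutative group (tree
  `monoidHom_symplecticGroup_gram_eq_one`, [Folland1989, Prop. (4.21)]);
* §2 **`LocalSplittingDatum.l2NormSq_r_apply`** — IF every `g ∈ Sp(𝕎_v)` admits SOME `L²(ν)`-isometric implementer
  on `𝒮(F_vᴺ)` (hypothesis `hE`; [Weil1964, Chap. I n° 13]: the metaplectic operators are unitary — for the tree's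
  model this is the remaining analytic input, provable on generators: dilations by the modulus of `det`, unimodular
  multipliers, partial Fourier transforms by Plancherel), THEN every `r(g)` is `L²(ν)`-isometric
  (`HeisenbergGroup/ImplementerSectionIsometric.lean`: the modulus of `r` is a homomorphism `Sp(𝕎_v) → ℝˣ`);
* §2 **`LocalSplittingDatum.isL2Isometric_localOmega`** — under `hE` and `|β(g)| = 1` for all `g` (Kudla's
  `β = κ χ_w(det C_g)` on the big cell with `χ` unitary), the local Weil representation `D.localOmega` of `U(J)(F_v)` is
  `L²(ν)`-ISOMETRIC (`Representation.IsL2Isometric`, `Automorphic/SchwartzBruhatL2Norm.lean`).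

Here `ν` is any measure on `F_vᴺ` charging non-empty open sets and finite on compacts (e.g. the product Haar measure;
Borel sets of `F_vᴺ` via `secondCountableTopology_adicCompletion`).
Use: with `Liu2021/LemD1DataOfPlaceIsometric.lean`, two families of local splittings that are `L²`-isometric at `v` give
the same reading of [Liu2021, App. D Lem. D.1 (1)] AS PRINTED at EVERY place; the present file says what «`L²`-isometric»
costs for the tree's own construction.  Nothing of [GelbartRogawski1991], [Kudla1994] or [Liu2021] is asserted.

## References
* [GelbartRogawski1991] S. Gelbart, J. Rogawski, Invent. Math. 105 (1991), §3.1 Prop. 3.1.1 p. 455.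
* [Kudla1994] S. S. Kudla, Israel J. Math. 87 (1994), Thm 3.1.
* [Weil1964] A. Weil, Acta Math. 111 (1964), Chap. I n° 13.
* [MoeglinVignerasWaldspurger1987] C. Mœglin, M.-F. Vignéras, J.-L. Waldspurger, LNM 1291 (1987), Chap. 2 II.1–II.2,
  Chap. 3 §I.3 remarque b).
* [Folland1989] G. B. Folland, *Harmonic Analysis in Phase Space*, §4.1 Prop. (4.21).
-/

set_option autoImplicit false

noncomputable section

open NumberField IsDedekindDomain _root_.MeasureTheory Matrix
open Literature.RepresentationTheory.HeisenbergGroup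
open Literature.NumberTheory.Automorphic Literature.NumberTheory.Weil1964

namespace Literature.NumberTheory.GelbartRogawski1991.UnitaryDualPair.LocalSplitting

variable {F : Type} [Field F] [NumberField F] {E : Type} [Field E] [NumberField E] [Algebra F E]
  [Algebra.IsQuadraticExtension F E] {c : E ≃ₐ[F] E} {N : ℕ} {δ : E} {hcδ : c δ = -δ} {hδ : δ ≠ 0} {d : F}
  {hd : δ * δ = algebraMap F E d} {T : Matrix (Fin N) (Fin N) F} {hT : T.IsSymm} {hTd : IsUnit T.det}
  {J : Matrix (Fin N) (Fin N) E} {hJ : J = T.map (algebraMap F E)} {v : HeightOneSpectrum (𝓞 F)}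
  [MeasurableSpace (v.adicCompletion F)] [BorelSpace (v.adicCompletion F)]
  {μ : Measure (v.adicCompletion F)} [μ.IsAddHaarMeasure]
  {ℓ : Submodule (v.adicCompletion F) ((Fin N → v.adicCompletion F) × (Fin N → v.adicCompletion F))}
  {hℓ : LinearMap.BilinForm.orthogonal (alt (polar (localPairing F N T v))) ℓ = ℓ}

/-! ## §1 The multiplier of the Leray-normalised section is unitary; `Sp(𝕎_v)` has no characters -/

/-- **the multiplier of the section `r` of a local splitting datum is unitary**: `|c_r(g₁, g₂)| = 1` — it is a Leray
cocycle `γ_{ψ'}(τ(ℓ, g₁ℓ, g₁g₂ℓ))`, a Weil index (tree `norm_lerayCocycle`).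
[cite: MoeglinVignerasWaldspurger1987, Chap. 3 §I.3, remarque b)] -/
theorem LocalSplittingDatum.norm_cocycle_eq_one (D : LocalSplittingDatum F E c N hcδ hδ hd T hT hTd hJ v μ ℓ hℓ)
    (g₁ g₂ : LocalSp F N T v) : ‖((D.r.cocycle D.hU g₁ g₂ : ℂˣ) : ℂ)‖ = 1 := by
  obtain ⟨ψ', hψ', h⟩ := D.cocycle_eq
  rw [h g₁ g₂, coe_localLeray_apply]
  exact norm_lerayCocycle μ hψ' _ _ _ _

omit [MeasurableSpace (v.adicCompletion F)] [BorelSpace (v.adicCompletion F)] in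
include hTd in
/-- **`Sp(𝕎_v)` has no non-trivial homomorphism to a commutative group** (`𝕎_v = F_vᴺ × F_vᴺ` with the Gram duality
`⟨x, 𝕋_v y⟩`, `det 𝕋_v` a unit, `char F_v = 0`; tree `monoidHom_symplecticGroup_gram_eq_one`).
[cite: Folland1989, §4.1 Prop. (4.21)] -/
theorem monoidHom_localSp_eq_one {A : Type*} [CommGroup A] (χ : LocalSp F N T v →* A) : χ = 1 := by
  haveI : CharZero (v.adicCompletion F) :=
    charZero_of_injective_algebraMap (algebraMap F (v.adicCompletion F)).injective
  exact monoidHom_symplecticGroup_gram_eq_one (localGram F N T v)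
    (UnitaryGroup.isUnit_det_map (algebraMap F (v.adicCompletion F)) hTd) χ

/-! ## §2 Isometric implementers + `|β| = 1` ⇒ `ω_v` is `L²`-isometric -/

variable (ν : Measure (Fin N → v.adicCompletion F)) [ν.IsOpenPosMeasure] [IsFiniteMeasureOnCompacts ν]

/-- **every operator `r(g)` of the Leray-normalised section is `L²(ν)`-isometric as soon as each `g ∈ Sp(𝕎_v)` has SOME
`L²(ν)`-isometric implementer** — the modulus of `r` is a homomorphism `Sp(𝕎_v) → ℝˣ` (`|c_r| = 1`), hence trivial.
[cite: Weil1964, Chap. I n° 13] [cite: MoeglinVignerasWaldspurger1987, Chap. 2 II.2] -/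
theorem LocalSplittingDatum.l2NormSq_r_apply (D : LocalSplittingDatum F E c N hcδ hδ hd T hT hTd hJ v μ ℓ hℓ)
    (hE : ∀ g : LocalSp F N T v, ∃ M : SchwartzBruhat (Fin N → v.adicCompletion F) ≃ₗ[ℂ]
        SchwartzBruhat (Fin N → v.adicCompletion F),
      Implements (localSchrodinger F N T v) (ofSymplectic _ g) M ∧
        ∀ Φ, SchwartzBruhat.l2NormSq ν (M Φ) = SchwartzBruhat.l2NormSq ν Φ)
    (g : LocalSp F N T v) (Φ : SchwartzBruhat (Fin N → v.adicCompletion F)) :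
    SchwartzBruhat.l2NormSq ν (D.r g Φ) = SchwartzBruhat.l2NormSq ν Φ := by
  haveI := secondCountableTopology_adicCompletion F v
  haveI : Nontrivial (SchwartzBruhat (Fin N → v.adicCompletion F)) := nontrivial_schwartzBruhat_pi
  obtain ⟨Φ₀, hΦ₀⟩ := exists_ne (0 : SchwartzBruhat (Fin N → v.adicCompletion F))
  exact D.r.normSq_apply_eq_of_monoidHom_eq_one D.hU (SchwartzBruhat.l2NormSq ν) (SchwartzBruhat.l2NormSq_smul ν)
    (SchwartzBruhat.l2NormSq_pos ν hΦ₀).ne' (SchwartzBruhat.l2NormSq_ne_top ν Φ₀) hE D.norm_cocycle_eq_one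
    (fun χ => monoidHom_localSp_eq_one (hTd := hTd) χ) g Φ

/-- **the local Weil representation `ω_v = β⁻¹ · r ∘ ι_v` of `U(J)(F_v)` is `L²(ν)`-isometric** as soon as each
`g ∈ Sp(𝕎_v)` has some `L²(ν)`-isometric implementer and Kudla's function is unitary, `|β(g)| = 1`.
[cite: Weil1964, Chap. I n° 13] [cite: Kudla1994, Thm 3.1] -/
theorem LocalSplittingDatum.isL2Isometric_localOmega (D : LocalSplittingDatum F E c N hcδ hδ hd T hT hTd hJ v μ ℓ hℓ)
    (hE : ∀ g : LocalSp F N T v, ∃ M : SchwartzBruhat (Fin N → v.adicCompletion F) ≃ₗ[ℂ]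
        SchwartzBruhat (Fin N → v.adicCompletion F),
      Implements (localSchrodinger F N T v) (ofSymplectic _ g) M ∧
        ∀ Φ, SchwartzBruhat.l2NormSq ν (M Φ) = SchwartzBruhat.l2NormSq ν Φ)
    (hβ : ∀ g : UnitaryGroup.localPi E c N J v, ‖((D.beta g : ℂˣ) : ℂ)‖ = 1) :
    D.localOmega.IsL2Isometric ν := by
  intro g Φ
  rw [D.localOmega_apply, Units.smul_def, SchwartzBruhat.l2NormSq_smul, D.l2NormSq_r_apply ν hE]
  have h1 : ‖(((D.beta g)⁻¹ : ℂˣ) : ℂ)‖ = 1 := by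
    rw [Units.val_inv_eq_inv_val, norm_inv, hβ g, inv_one]
  rw [← ofReal_norm, h1, ENNReal.ofReal_one, one_pow, one_mul]

end Literature.NumberTheory.GelbartRogawski1991.UnitaryDualPair.LocalSplitting

end
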